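import Literature.AnabelianGeometry.SemiGraphs.TemperedPiLevelKernelVertGen
import Literature.AnabelianGeometry.SemiGraphs.SubgroupPresentationGenerators
import Literature.AnabelianGeometry.AbsoluteAnabelian.ProfiniteTerminology
import HarnessLib

/-!
# `π₁^temp(𝒢)` is topologically finitely generated for a finite semi-graph of anabelioids with
# topologically finitely generated vertex groups ([SemiAnbd] Prop 3.6 p. 38, Def 2.3 (iii), Def 5.1 (i))

Mochizuki, *Semi-graphs of anabelioids*, Publ. RIMS **42** (2006), Prop. 3.6 p. 38 (`π₁^temp(𝒢) :=
lim_i Gal(𝒢_{∞,i}/𝒢)`), Def. 2.3 (iii) p. 25 ("coherent": topologically finitely generated constituent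
fundamental groups) and Def. 5.1 (i) p. 62 (the standing "coherent" of the arithmetic setting)
[cite: MochizukiSemiAnbd2006, Prop 3.6 p.38]; group theory: Serre, *Trees*, I §5.4 (generation half of the
structure theorem).

PROOF-ONLY (cell row T54-B, plan/GAP-LEDGER.md G-w4d053-1: the capstone input «finitely many open
subgroups of `π₁^temp(𝒢)` of each index», binder `hfin` of abc-iut-w4-d053's `charOpenCore` family, reduces
by abc-iut-w4-d053's `openSubgroupsIndexLE_finite_of_isTopologicallyFinitelyGenerated` to the present
theorem; also G-L5t11g6-1's cofinal characteristic open subgroups via `charOpenCore_family_of_tfg`).  At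
abc-iut-L3-t9's Galois tower `D` with abc-iut-L3-d4's presentation `P := D.piPresentation T R`:

* `exists_mem_mul_ker_projAut` — `π₁^temp = Λ · ker ρ_m` for every `m` and every subgroup `Λ` containing the
  vertex groups `H_w` and the branch elements `s_b` (`SubgroupPresentation.exists_mem_mul_of_isConnected`
  at the TREE `cosetGraph (ker ρ_m) ≅ 𝔾̃_m`, `piPresentation_hT`);
* `eq_top_of_isClosed` — such a `Λ`, if closed, is all of `π₁^temp` (the `ker ρ_m` form a neighbourhood basis
  of `1`, `exists_ker_projAut_subset`);
* **`isTopologicallyFinitelyGenerated_temperedPi`** — for `𝔾` finite (`[Finite Vertex] [Finite Branch]`) and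
  every `Π_w = 𝒢.Gv w` topologically finitely generated, `π₁^temp(𝒢)` is topologically finitely
  generated: by the images under the decomposition homomorphisms `decompHom` of finite topological
  generating sets of the `Π_w`, together with the finitely many branch elements `s_b`.

Nothing here refers to the IUT corpus; no side is taken on [IUTchIII] Cor 3.12; typed ≠ proved for Thm 5.4 itself.
-/

namespace Literature.AnabelianGeometry.SemiGraphs

namespace ProfiniteSemiGraph

namespace GaloisLevelData

open CategoryTheory Topology
open Literature.AnabelianGeometry.AbsoluteAnabelian (IsTopologicallyFinitelyGenerated)

universe u

variable {𝒢 : ProfiniteSemiGraph.{u}} (D : GaloisLevelData 𝒢) (h𝒢 : 𝒢.IsCountable)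
  (T : ∀ w : 𝒢.graph.Vertex, D.PointSeq h𝒢 w) (R : SemiGraph.RefBranches 𝒢.graph)

/-- **`π₁^temp(𝒢) = Λ · ker ρ_m`** for every tree level `m` and every subgroup `Λ` containing the vertex
groups `H_w` and the branch elements `s_b` of the presentation (generation half of Bass–Serre at the tree
`cosetGraph (ker ρ_m)`). [cite: MochizukiSemiAnbd2006, Thm 3.7(iii) p.41] -/
theorem exists_mem_mul_ker_projAut (Λ : Subgroup (D.temperedPi h𝒢))
    (hH : ∀ w, (D.piPresentation h𝒢 T R).H w ≤ Λ) (hs : ∀ b, (D.piPresentation h𝒢 T R).s b ∈ Λ)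
    (m : ℕ) (g : D.temperedPi h𝒢) : ∃ γ ∈ Λ, ∃ k ∈ (D.projAut h𝒢 m).ker, g = γ * k :=
  (D.piPresentation h𝒢 T R).exists_mem_mul_of_isConnected _ Λ hH hs
    ⟨(D.piPresentation_hT h𝒢 T R m).isTree.connected⟩ D.v₀ g

/-- **A CLOSED subgroup of `π₁^temp(𝒢)` containing the vertex groups and the branch elements is everything**
(the `ker ρ_m` form a neighbourhood basis of `1`). [cite: MochizukiSemiAnbd2006, Prop 3.6(i) p.38] -/
theorem eq_top_of_isClosed (Λ : Subgroup (D.temperedPi h𝒢))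
    (hH : ∀ w, (D.piPresentation h𝒢 T R).H w ≤ Λ) (hs : ∀ b, (D.piPresentation h𝒢 T R).s b ∈ Λ)
    (hΛ : IsClosed (Λ : Set (D.temperedPi h𝒢))) : Λ = ⊤ := by
  refine top_le_iff.mp fun x _ => ?_
  have hx : x ∈ closure (Λ : Set (D.temperedPi h𝒢)) := by
    rw [mem_closure_iff_nhds]
    intro t ht
    have hU : (fun g : D.temperedPi h𝒢 => x * g) ⁻¹' t ∈ 𝓝 (1 : D.temperedPi h𝒢) := by
      have hc : Continuous fun g : D.temperedPi h𝒢 => x * g := continuous_const.mul continuous_id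
      refine hc.continuousAt.preimage_mem_nhds ?_
      rwa [mul_one]
    obtain ⟨m, hm⟩ := D.exists_ker_projAut_subset h𝒢 hU
    obtain ⟨γ, hγ, k, hk, hxe⟩ := D.exists_mem_mul_ker_projAut h𝒢 T R Λ hH hs m x
    refine ⟨γ, ?_, hγ⟩
    have h1 : x * k⁻¹ = γ := by rw [hxe]; group
    rw [← h1]
    exact hm (Subgroup.inv_mem _ hk)
  rwa [hΛ.closure_eq] at hx

include T R in
/-- **`π₁^temp(𝒢)` is topologically finitely generated** when `𝔾` is finite and every vertex group
`Π_w` is topologically finitely generated ([SemiAnbd] "coherent", Def. 2.3 (iii)): generated topologically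
by the `decompHom`-images of finite topological generating sets of the `Π_w` and the branch elements `s_b`.
[cite: MochizukiSemiAnbd2006, Prop 3.6(i) p.38] -/
theorem isTopologicallyFinitelyGenerated_temperedPi [Finite 𝒢.graph.Vertex] [Finite 𝒢.graph.Branch]
    (hfg : ∀ w, IsTopologicallyFinitelyGenerated (𝒢.Gv w)) :
    IsTopologicallyFinitelyGenerated (D.temperedPi h𝒢) := by
  classical
  haveI := Fintype.ofFinite 𝒢.graph.Vertex
  haveI := Fintype.ofFinite 𝒢.graph.Branch
  choose s hs using fun w => (hfg w).exists_finset
  -- the finite generating set: images of the `s w` under `decompHom`, and the branch elements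
  refine ⟨⟨(Finset.univ.biUnion fun w => (s w).image (T w).decompHom) ∪
    Finset.univ.image (D.piPresentation h𝒢 T R).s, ?_⟩⟩
  refine D.eq_top_of_isClosed h𝒢 T R _ (fun w => ?_) (fun b => ?_)
    (Subgroup.isClosed_topologicalClosure _)
  · -- `H_w = decompHom(Π_w) = decompHom(closure ⟨s w⟩⁻) ≤ closure of `decompHom ⟨s w⟩` ≤ Λ`
    rw [D.piPresentation_H h𝒢 T R w, MonoidHom.range_eq_map, ← hs w]
    rintro _ ⟨y, hy, rfl⟩
    have h1 : (T w).decompHom y ∈ closure ((T w).decompHom ''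
        (Subgroup.closure ((s w : Finset (𝒢.Gv w)) : Set (𝒢.Gv w)) : Set (𝒢.Gv w))) :=
      image_closure_subset_closure_image (T w).continuous_decompHom ⟨y, hy, rfl⟩
    have h2 : ((T w).decompHom '' (Subgroup.closure ((s w : Finset (𝒢.Gv w)) : Set (𝒢.Gv w)) :
        Set (𝒢.Gv w))) ⊆
        (Subgroup.closure (((Finset.univ.biUnion fun w => (s w).image (T w).decompHom) ∪
          Finset.univ.image (D.piPresentation h𝒢 T R).s : Finset (D.temperedPi h𝒢)) :
            Set (D.temperedPi h𝒢)) : Set (D.temperedPi h𝒢)) := by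
      rw [← Subgroup.coe_map, MonoidHom.map_closure]
      refine Subgroup.closure_mono ?_
      rintro _ ⟨z, hz, rfl⟩
      simp only [Finset.coe_union, Finset.coe_biUnion, Finset.coe_univ, Set.mem_univ, Set.iUnion_true,
        Finset.coe_image, Set.mem_union, Set.mem_iUnion, Set.mem_image, Finset.mem_coe]
      exact Or.inl ⟨w, z, hz, rfl⟩
    exact closure_mono h2 h1
  · exact Subgroup.le_topologicalClosure _ (Subgroup.subset_closure (by simp))

end GaloisLevelData

end ProfiniteSemiGraph

end Literature.AnabelianGeometry.SemiGraphs
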